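import Mathlib
import Summits.CriticalPhenomena.PercolationContinuityZ3.Theses.PercHyperscalingGluing
import Summits.CriticalPhenomena.PercolationContinuityZ3.Theses.PercAnnulusCrossing
import Summits.CriticalPhenomena.PercolationContinuityZ3.Theorems.PercNonProliferationFreeBoxPowerSavingOneArmDictionary
import Summits.CriticalPhenomena.PercolationContinuityZ3.Theorems.PercNonProliferationSubpolynomialBlockingMeanSpanningOfCrux
import Summits.CriticalPhenomena.PercolationContinuityZ3.Theorems.PercNonProliferationSpanningBKCap
import Summits.CriticalPhenomena.PercolationContinuityZ3.Theorems.FreeBoxSparse.Negative.CentredForms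
import HarnessLib

/-!
# Route `PercHyperscalingGluing`, crux `BoxGluing` (stmt-CriticalPhenomena-4643): the cone edge
# `CritAnnulusNonCrossing ⟹ BoxGluing` (Borgs–Chayes–Kesten–Spencer, exponent-free)

Helper file (`--supports stmt-CriticalPhenomena-4643`) of the line lead of crux `BoxGluing`.  It lands a
CONDITIONAL proof of the crux from ONE other open crux of the same sub-problem plus landed material only:

* `boxGluing_of_meanSpanningBounded` — **bounded mean spanning number ⟹ `BoxGluing` (K = 2)**:
  if the mean number `E[N_n]` of pairwise-unjoined sites of `B(n)` armed to `∂ⁱⁿB(2n)` inside `B(2n)`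
  (= mean number of distinct `B(2n)`-clusters meeting `B(n)` and `∂ⁱⁿB(2n)`, in the tail-sum form of route
  `PercNonProliferation`) is bounded by `M` for all `n ≥ 1`, then
  `|Λ_m| π_m² ≤ (1728 M + 343) Σ_{x∈Λ_m} τ^{Λ_{2m}}(0,x)` for all `m ≥ 1`, hence `BoxGluing` with
  `C = 1728 M + 343`, `K = 2`.  Chain at one scale `n` (`oneScale`): the landed arm–spanning-pair inequality
  `FreeBoxPowerSavingLine.stub_armSpanningPair` (`π(3n)² ≤ 64·E[N_n]·PS(2n)/|B(2n)|²`, route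
  PercNonProliferation, Cauchy–Schwarz over spanning clusters = BCKS / Aizenman's proliferation count) and the
  landed re-rooting `FreeBoxSparse.Negative.pairSum_le_card_mul_centredSum` (`PS(2n) ≤ |B(2n)| Σ_{z∈B(4n)}
  τ^{B(4n)}(0,z)`); then a change of scale `m ∈ [4n, 4n+3]` (`π_m ≤ π_{3n}`, `|Λ_m| ≤ 27|B(2n)|`,
  `B(4n) ⊆ Λ_m`, `Λ_{4n} ⊆ Λ_{2m}`), small `m ≤ 3` by the `x = 0` term.
* `boxGluing_of_critAnnulusNonCrossing` — **`PercAnnulusCrossing.CritAnnulusNonCrossing` (X_B,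
  stmt-CriticalPhenomena-0846) ⟹ `BoxGluing`**: X_B gives the blocking probability `u_n ≥ c`, the landed BK cap
  (`spanningBKCap_proof`, `SubpolynomialBlocking.meanSpanning_le_one_div_blocking`) gives `E[N_n] ≤ 1/u_n ≤ 1/c`.
  This is Borgs–Chayes–Kesten–Spencer 1999 ("uniform crossing bounds imply hyperscaling"), here in the
  exponent-free, box-restricted form of the crux: item 4643 closes the moment item 0846 does.

Found by the line's stub-worker for `stub_weakGluing` (scratch kernel-checked by the lead); pure proof file,
no definitions; every statement is over existing declarations.
-/

noncomputable section

namespace Summit.CriticalPhenomena.PercolationContinuityZ3.Theorems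

open MeasureTheory
open Literature.Probability.Percolation Literature.Probability.LatticeModels
open Literature.Barriers.CriticalPhenomena (annulusCrossing)
open Summit.CriticalPhenomena.PercolationContinuityZ3.Theses
open Summit.CriticalPhenomena.PercolationContinuityZ3.Theorems.SubpolynomialBlocking.Negative
  (blockProb blockProb_eq)

namespace BoxGluingOfCritAnnulusNonCrossing

/-! ### Bookkeeping -/

/-- Monotonicity of the in-box two-point sum in the box: `Σ_{x∈S} τ^{Λ_a}(0,x) ≤ Σ_{x∈S} τ^{Λ_b}(0,x)`
for `a ≤ b`. [folklore] -/
theorem sum_openConnIn_mono {a b : ℕ} (hab : a ≤ b) (S : Finset (Site 3)) :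
    ∑ x ∈ S, (bondPercolation (zdGraph 3) (criticalProbI 3)).real (openConnIn ↑(box 3 a) 0 x) ≤
      ∑ x ∈ S, (bondPercolation (zdGraph 3) (criticalProbI 3)).real (openConnIn ↑(box 3 b) 0 x) :=
  Finset.sum_le_sum fun x _ => measureReal_mono
    (openConnIn_mono (Finset.coe_subset.2 (box_mono 3 hab)) 0 x)

/-- Monotonicity of the in-box two-point sum in the box and in the range of summation. [folklore] -/
theorem sum_openConnIn_mono₂ {a b : ℕ} (hab : a ≤ b) {S T : Finset (Site 3)} (hST : S ⊆ T) :
    ∑ x ∈ S, (bondPercolation (zdGraph 3) (criticalProbI 3)).real (openConnIn ↑(box 3 a) 0 x) ≤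
      ∑ x ∈ T, (bondPercolation (zdGraph 3) (criticalProbI 3)).real (openConnIn ↑(box 3 b) 0 x) :=
  (sum_openConnIn_mono hab S).trans
    (Finset.sum_le_sum_of_subset_of_nonneg hST fun _ _ _ => measureReal_nonneg)

/-- `P(0 ↔ 0 in Λ_a) = 1`. [folklore] -/
theorem real_openConnIn_self (a : ℕ) :
    (bondPercolation (zdGraph 3) (criticalProbI 3)).real (openConnIn ↑(box 3 a) (0 : Site 3) 0) = 1 := by
  have : (openConnIn (↑(box 3 a) : Set (Site 3)) (0 : Site 3) 0) = Set.univ :=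
    Set.eq_univ_of_forall fun _ => openConnIn_refl (Finset.mem_coe.2 (zero_mem_box 3 _))
  rw [this, probReal_univ]

/-- The `x = 0` term: `1 ≤ Σ_{x∈Λ_m} τ^{Λ_a}(0,x)`. [folklore] -/
theorem one_le_sum_openConnIn (m a : ℕ) :
    (1 : ℝ) ≤ ∑ x ∈ box 3 m, (bondPercolation (zdGraph 3) (criticalProbI 3)).real
      (openConnIn ↑(box 3 a) 0 x) := by
  rw [← real_openConnIn_self a]
  exact Finset.single_le_sum (fun z _ => measureReal_nonneg) (zero_mem_box 3 m)

/-! ### One scale: the BCKS chain -/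

/-- **One scale.** If the mean spanning number of the annulus `B(n) → ∂ⁱⁿB(2n)` (tail-sum form) is at most
`M` at scale `n ≥ 1`, then `|B(2n)| · π_{3n}² ≤ 64 M · Σ_{z ∈ B(4n)} τ^{B(4n)}(0,z)`: the landed
arm–spanning-pair inequality `FreeBoxPowerSavingLine.stub_armSpanningPair` and the landed re-rooting
`FreeBoxSparse.Negative.pairSum_le_card_mul_centredSum`. [cite: BorgsChayesKestenSpencer1999, Thm 1.1 (uniform crossing bounds ⟹ hyperscaling; the one-scale second-moment step)] -/
theorem oneScale {M : ℝ} (hM : 0 < M) {n : ℕ} (hn : 1 ≤ n)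
    (hEN : (∑ k ∈ Finset.range (box 3 n).card, (bondPercolation (zdGraph 3) (criticalProbI 3)).real
        {ω | ∃ x : Fin (k + 1) → Site 3, (∀ i, x i ∈ box 3 n) ∧
          (∀ i, ∃ y ∈ innerBoundary (zdGraph 3) (box 3 (2 * n)),
            ω ∈ openConnIn ↑(box 3 (2 * n)) (x i) y) ∧
          ∀ i j, i ≠ j → ω ∉ openConnIn ↑(box 3 (2 * n)) (x i) (x j)}) ≤ M) :
    ((box 3 (2 * n)).card : ℝ) *
        (bondPercolation (zdGraph 3) (criticalProbI 3)).real (siteToBoundary 3 (3 * n)) ^ 2 ≤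
      64 * M * ∑ z ∈ box 3 (2 * (2 * n)), (bondPercolation (zdGraph 3) (criticalProbI 3)).real
        (openConnIn ↑(box 3 (2 * (2 * n))) 0 z) := by
  set P := bondPercolation (zdGraph 3) (criticalProbI 3) with hP
  set c2 : ℝ := ((box 3 (2 * n)).card : ℝ) with hc2
  set EN : ℝ := ∑ k ∈ Finset.range (box 3 n).card, P.real
        {ω | ∃ x : Fin (k + 1) → Site 3, (∀ i, x i ∈ box 3 n) ∧
          (∀ i, ∃ y ∈ innerBoundary (zdGraph 3) (box 3 (2 * n)),
            ω ∈ openConnIn ↑(box 3 (2 * n)) (x i) y) ∧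
          ∀ i j, i ≠ j → ω ∉ openConnIn ↑(box 3 (2 * n)) (x i) (x j)} with hENdef
  set PS : ℝ := ∑ x ∈ box 3 (2 * n), ∑ y ∈ box 3 (2 * n),
      P.real (openConnIn (↑(box 3 (2 * n)) : Set (Site 3)) x y) with hPS
  set S4 : ℝ := ∑ z ∈ box 3 (2 * (2 * n)), P.real (openConnIn ↑(box 3 (2 * (2 * n))) 0 z) with hS4
  have hc2pos : 0 < c2 := FreeBoxSparse.Negative.card_box_pos' _
  have hPS0 : 0 ≤ PS := Finset.sum_nonneg fun _ _ => Finset.sum_nonneg fun _ _ => measureReal_nonneg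
  -- ASP (landed): π(3n)² ≤ 64 · E[N_n] · (PS / c2²)
  have hasp : P.real (siteToBoundary 3 (3 * n)) ^ 2 ≤ 64 * EN * (PS / c2 ^ 2) :=
    Summit.CriticalPhenomena.PercolationContinuityZ3.FreeBoxPowerSavingLine.stub_armSpanningPair
      (criticalProbI 3) n hn
  -- re-rooting (landed): PS ≤ c2 · S4
  have hps : PS ≤ c2 * S4 :=
    Summit.CriticalPhenomena.PercolationContinuityZ3.Theorems.FreeBoxSparse.Negative.pairSum_le_card_mul_centredSum
      (criticalProbI 3) (2 * n)
  have hENle : EN ≤ M := hEN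
  have h1 : P.real (siteToBoundary 3 (3 * n)) ^ 2 ≤ 64 * M * (c2 * S4 / c2 ^ 2) :=
    hasp.trans (mul_le_mul (by linarith) (div_le_div_of_nonneg_right hps (sq_nonneg _))
      (div_nonneg hPS0 (sq_nonneg _)) (by positivity))
  have h2 : 64 * M * (c2 * S4 / c2 ^ 2) = 64 * M * S4 / c2 := by
    field_simp
  rw [h2, le_div_iff₀ hc2pos] at h1
  linarith

/-- **All scales, product form.** If the mean spanning number is at most `M` at every scale `n ≥ 1`, then
`|Λ_m| π_m² ≤ (1728 M + 343) Σ_{x∈Λ_m} τ^{Λ_{2m}}(0,x)` for every `m ≥ 1`: for `m ≥ 4` apply `oneScale`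
at `n = ⌊m/4⌋` and change scale (`π_m ≤ π_{3n}`, `|Λ_m| ≤ 27 |B(2n)|`, `B(4n) ⊆ Λ_m`,
`Λ_{4n} ⊆ Λ_{2m}`); for `m ≤ 3` (including `m = 0`) use `|Λ_m| ≤ 343` and the `x = 0` term.
[cite: BorgsChayesKestenSpencer1999, Thm 1.1 (uniform crossing bounds ⟹ hyperscaling)] -/
theorem productGluing_of_meanSpanningBounded {M : ℝ} (hM : 0 < M)
    (hEN : ∀ n : ℕ, 1 ≤ n →
      (∑ k ∈ Finset.range (box 3 n).card, (bondPercolation (zdGraph 3) (criticalProbI 3)).real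
        {ω | ∃ x : Fin (k + 1) → Site 3, (∀ i, x i ∈ box 3 n) ∧
          (∀ i, ∃ y ∈ innerBoundary (zdGraph 3) (box 3 (2 * n)),
            ω ∈ openConnIn ↑(box 3 (2 * n)) (x i) y) ∧
          ∀ i j, i ≠ j → ω ∉ openConnIn ↑(box 3 (2 * n)) (x i) (x j)}) ≤ M)
    (m : ℕ) :
    ((box 3 m).card : ℝ) *
        (bondPercolation (zdGraph 3) (criticalProbI 3)).real (siteToBoundary 3 m) ^ 2 ≤
      (27 * (64 * M) + 343) * ∑ x ∈ box 3 m, (bondPercolation (zdGraph 3) (criticalProbI 3)).real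
        (openConnIn ↑(box 3 (2 * m)) 0 x) := by
  set P := bondPercolation (zdGraph 3) (criticalProbI 3) with hP
  set S' : ℝ := ∑ x ∈ box 3 m, P.real (openConnIn ↑(box 3 (2 * m)) 0 x) with hS'
  have hS'1 : 1 ≤ S' := one_le_sum_openConnIn m (2 * m)
  have hπ1 : P.real (siteToBoundary 3 m) ^ 2 ≤ 1 := pow_le_one₀ measureReal_nonneg measureReal_le_one
  have hπ0 : 0 ≤ P.real (siteToBoundary 3 m) ^ 2 := sq_nonneg _
  rcases Nat.lt_or_ge m 4 with hm4 | hm4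
  · -- small scales `m ∈ {1,2,3}`: `|Λ_m| π_m² ≤ 343 ≤ C · S'`
    have hcm : ((box 3 m).card : ℝ) ≤ 343 := by
      have : (box 3 m).card ≤ 343 := by
        rw [card_box]
        calc (2 * m + 1) ^ 3 ≤ 7 ^ 3 := Nat.pow_le_pow_left (by omega) 3
          _ = 343 := by norm_num
      exact_mod_cast this
    calc ((box 3 m).card : ℝ) * P.real (siteToBoundary 3 m) ^ 2 ≤ 343 * 1 :=
          mul_le_mul hcm hπ1 hπ0 (by norm_num)
      _ ≤ (27 * (64 * M) + 343) * S' := by nlinarith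
  · -- `m ≥ 4`: `n = ⌊m/4⌋ ≥ 1`, `4n ≤ m ≤ 4n + 3`
    obtain ⟨n, hn1, hnm, hmn⟩ : ∃ n : ℕ, 1 ≤ n ∧ 4 * n ≤ m ∧ m ≤ 4 * n + 3 :=
      ⟨m / 4, by omega, by omega, by omega⟩
    have hone := oneScale hM hn1 (hEN n hn1)
    -- |Λ_m| ≤ 27 |B(2n)|
    have hcm : ((box 3 m).card : ℝ) ≤ 27 * ((box 3 (2 * n)).card : ℝ) := by
      have : (box 3 m).card ≤ 27 * (box 3 (2 * n)).card := by
        rw [card_box, card_box]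
        calc (2 * m + 1) ^ 3 ≤ (3 * (2 * (2 * n) + 1)) ^ 3 := Nat.pow_le_pow_left (by omega) 3
          _ = 27 * (2 * (2 * n) + 1) ^ 3 := by ring
      exact_mod_cast this
    -- π_m ≤ π_{3n}
    have hπ : P.real (siteToBoundary 3 m) ^ 2 ≤ P.real (siteToBoundary 3 (3 * n)) ^ 2 :=
      pow_le_pow_left₀ measureReal_nonneg (DCT16.real_siteToBoundary_antitone _ (by omega)) 2
    -- S4 ≤ S'
    have hS : ∑ z ∈ box 3 (2 * (2 * n)), P.real (openConnIn ↑(box 3 (2 * (2 * n))) 0 z) ≤ S' :=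
      sum_openConnIn_mono₂ (by omega) (box_mono 3 (by omega))
    calc ((box 3 m).card : ℝ) * P.real (siteToBoundary 3 m) ^ 2
        ≤ 27 * ((box 3 (2 * n)).card : ℝ) * P.real (siteToBoundary 3 (3 * n)) ^ 2 :=
          mul_le_mul hcm hπ hπ0 (by positivity)
      _ = 27 * (((box 3 (2 * n)).card : ℝ) * P.real (siteToBoundary 3 (3 * n)) ^ 2) := by ring
      _ ≤ 27 * (64 * M * ∑ z ∈ box 3 (2 * (2 * n)), P.real (openConnIn ↑(box 3 (2 * (2 * n))) 0 z)) :=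
          mul_le_mul_of_nonneg_left hone (by norm_num)
      _ ≤ 27 * (64 * M * S') := by gcongr
      _ ≤ (27 * (64 * M) + 343) * S' := by nlinarith

/-- **Bounded mean spanning number under X_B**: `CritAnnulusNonCrossing` gives the blocking probability
`u_n ≥ c > 0`, and the landed BK cap (`spanningBKCap_proof`, summed as a geometric series in
`SubpolynomialBlocking.meanSpanning_le_one_div_blocking`) gives `E[N_n] ≤ 1/u_n ≤ 1/c` for all `n ≥ 1`.
[cite: BorgsChayesKestenSpencer1999, §1 (BK bound on the number of spanning clusters)] -/
theorem meanSpanning_le_of_critAnnulusNonCrossing (h : PercAnnulusCrossing.CritAnnulusNonCrossing) :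
    ∃ M : ℝ, 0 < M ∧ ∀ n : ℕ, 1 ≤ n →
      (∑ k ∈ Finset.range (box 3 n).card, (bondPercolation (zdGraph 3) (criticalProbI 3)).real
        {ω | ∃ x : Fin (k + 1) → Site 3, (∀ i, x i ∈ box 3 n) ∧
          (∀ i, ∃ y ∈ innerBoundary (zdGraph 3) (box 3 (2 * n)),
            ω ∈ openConnIn ↑(box 3 (2 * n)) (x i) y) ∧
          ∀ i j, i ≠ j → ω ∉ openConnIn ↑(box 3 (2 * n)) (x i) (x j)}) ≤ M := by
  obtain ⟨c, hc, hcross⟩ := h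
  refine ⟨1 / c, by positivity, fun n hn => ?_⟩
  have hu : c ≤ blockProb 3 (criticalProbI 3) n := by
    have heq := blockProb_eq 3 (criticalProbI 3) n
    have h := hcross n hn
    change (bondPercolation (zdGraph 3) (criticalProbI 3)).real (annulusCrossing 3 n) ≤ 1 - c at h
    linarith
  have hu0 : 0 < blockProb 3 (criticalProbI 3) n := hc.trans_le hu
  calc _ ≤ 1 / blockProb 3 (criticalProbI 3) n :=
        SubpolynomialBlocking.meanSpanning_le_one_div_blocking spanningBKCap_proof n hu0
    _ ≤ 1 / c := one_div_le_one_div_of_le hc hu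

end BoxGluingOfCritAnnulusNonCrossing

open BoxGluingOfCritAnnulusNonCrossing

/-- **Bounded mean spanning number ⟹ the crux `BoxGluing` (with `K = 2`).**  If for some `M` the mean number
`E[N_n] = Σ_k P(N_n ≥ k+1)` of pairwise-unjoined (inside `B(2n)`) sites of `B(n)` joined to `∂ⁱⁿB(2n)` inside
`B(2n)` is at most `M` for every `n ≥ 1` (Borgs–Chayes–Kesten–Spencer's tightness hypothesis in mean form;
FALSE for `d > 6`, Aizenman 1997 Thm 4), then `π_n² ≤ (1728 M + 343) |Λ_n|⁻¹ Σ_{x∈Λ_n} τ^{Λ_{2n}}(0,x)` for all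
`n ≥ 1`: the exponent-free, box-restricted "≤" half of hyperscaling `2/ρ ≥ d − 2 + η`.
[cite: BorgsChayesKestenSpencer1999, Thm 1.1 (uniform crossing bounds ⟹ hyperscaling)] -/
theorem boxGluing_of_meanSpanningBounded {M : ℝ} (hM : 0 < M)
    (hEN : ∀ n : ℕ, 1 ≤ n →
      (∑ k ∈ Finset.range (box 3 n).card, (bondPercolation (zdGraph 3) (criticalProbI 3)).real
        {ω | ∃ x : Fin (k + 1) → Site 3, (∀ i, x i ∈ box 3 n) ∧
          (∀ i, ∃ y ∈ innerBoundary (zdGraph 3) (box 3 (2 * n)),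
            ω ∈ openConnIn ↑(box 3 (2 * n)) (x i) y) ∧
          ∀ i j, i ≠ j → ω ∉ openConnIn ↑(box 3 (2 * n)) (x i) (x j)}) ≤ M) :
    PercHyperscalingGluing.BoxGluing := by
  refine ⟨27 * (64 * M) + 343, 2, by positivity, by norm_num, fun n _ => ?_⟩
  have hcard := FreeBoxSparse.Negative.card_box_pos' n
  have h1 := productGluing_of_meanSpanningBounded hM hEN n
  rw [show (27 * (64 * M) + 343) * ((box 3 n).card : ℝ)⁻¹ *
      ∑ x ∈ box 3 n, (bondPercolation (zdGraph 3) (criticalProbI 3)).real (openConnIn ↑(box 3 (2 * n)) 0 x) =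
      ((27 * (64 * M) + 343) * ∑ x ∈ box 3 n, (bondPercolation (zdGraph 3) (criticalProbI 3)).real
        (openConnIn ↑(box 3 (2 * n)) 0 x)) / ((box 3 n).card : ℝ) by ring]
  rw [le_div_iff₀ hcard, mul_comm]
  exact h1

/-- **Cone edge `CritAnnulusNonCrossing ⟹ BoxGluing`** (item stmt-CriticalPhenomena-0846 of route
`PercAnnulusCrossing` ⟹ item stmt-CriticalPhenomena-4643 of route `PercHyperscalingGluing`): the 3D RSW-type
upper bound X_B (`P_{p_c}(B(n) ↔ ∂ⁱⁿB(2n) in B(2n)) ≤ 1 − c`) bounds the mean spanning number by `1/c`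
(`meanSpanning_le_of_critAnnulusNonCrossing`), and bounded mean spanning number gives the crux
(`boxGluing_of_meanSpanningBounded`), with `C = 1728/c + 343`, `K = 2`.  Borgs–Chayes–Kesten–Spencer 1999,
"uniform boundedness of critical crossing probabilities implies hyperscaling", exponent-free.  Conditional
result: `BoxGluing` closes when `CritAnnulusNonCrossing` does.
[cite: BorgsChayesKestenSpencer1999, Thm 1.1 (uniform crossing bounds ⟹ hyperscaling)] -/
theorem boxGluing_of_critAnnulusNonCrossing :
    Summit.CriticalPhenomena.PercolationContinuityZ3.Theses.PercAnnulusCrossing.CritAnnulusNonCrossing →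
      Summit.CriticalPhenomena.PercolationContinuityZ3.Theses.PercHyperscalingGluing.BoxGluing := by
  intro h
  obtain ⟨M, hM, hEN⟩ := meanSpanning_le_of_critAnnulusNonCrossing h
  exact boxGluing_of_meanSpanningBounded hM hEN

/-- **Cross-route assembly**: X_B (`CritAnnulusNonCrossing`, stmt-0846), free-box shattering
(`PercHyperscalingGluing.FreeBoxShattering`, stmt-4644) and the known one-arm bound `ThetaLeOneArm` give
`θ(p_c) = 0` on `ℤ³`, through the deciding theorem `PercHyperscalingGluing.closes`.
[cite: BorgsChayesKestenSpencer1999, Thm 1.1] -/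
theorem percolationContinuityZ3_of_critAnnulusNonCrossing_of_freeBoxShattering
    (h : PercAnnulusCrossing.CritAnnulusNonCrossing) (hF : PercHyperscalingGluing.FreeBoxShattering)
    (hT : PercHyperscalingGluing.ThetaLeOneArm) : _root_.PercolationContinuityZ3 :=
  PercHyperscalingGluing.closes (boxGluing_of_critAnnulusNonCrossing h) hF hT

end Summit.CriticalPhenomena.PercolationContinuityZ3.Theorems

end
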